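import Literature.NumberTheory.GaloisRepresentations.DeRhamLAdicCharacterHeckeReduction
import Literature.NumberTheory.PAdicHodge.DeRhamRankOneLocallyAlgebraicDegreeOne
import Literature.NumberTheory.NumberFields.AdicCompletionResidueCardUniformizerOfPadicIntEquiv
import Literature.NumberTheory.GaloisRepresentations.PadicAlgebraDegreeOnePlace
import Mathlib.NumberTheory.Padics.HeightOneSpectrum
import HarnessLib

/-!
# A de Rham `ℓ`-adic character of `Γ_ℚ` comes from an algebraic Hecke character (unconditional)

Topic `NumberTheory/GaloisRepresentations`; namespace `Literature.NumberTheory.GaloisRepresentations`.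
Proof file (theorems only; no definition, no named fact, no instance).

The tree keeps Patrikis' Prop. 2.2.1 / Serre's Ch. III §2.3 Thm. 2 with App. A ("a continuous
`ψ : Γ_K → GL₁(ℚ̄_ℓ)` that is de Rham at every `v ∣ ℓ` for Fontaine's pinned datum comes from an algebraic
Hecke character") as the named fact `FramedGaloisRep.exists_heckeCharacter_of_isDeRhamFramed`, and
`DeRhamLAdicCharacterHeckeReduction` reduces it to ONE local input (hloc): Tate's theorem that de Rham
(Hodge–Tate) characters of a `p`-adic field are locally algebraic.  This file PROVES the `K = ℚ` instance
of the fact, unconditionally: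

* `FramedGaloisRep.exists_heckeCharacter_of_local_at` — the reduction with (hloc) required only at the
  completions `K_v`, `v ∣ ℓ`, of the given number field `K` and the given `ψ` (the printed proof uses
  nothing more; same assembly as `exists_heckeCharacter_of_isDeRhamFramed_of_local`).
* `exists_isOpen_eq_prod_toLocal_rat` — (hloc) at `ℚ_v`, `v ∣ ℓ`: `ℚ_v ≅ ℚ_ℓ` has `e = f = 1`
  (`𝒪_v ≅ ℤ_ℓ`, Mathlib `Rat.HeightOneSpectrum.adicCompletionIntegers.padicIntEquiv`; `ℓ` is a
  uniformizer and the residue field has `ℓ` elements,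
  `isUniformizer_natCast_adicCompletion_of_padicIntEquiv`, `residueFieldCard_adicCompletion_of_padicIntEquiv`)
  and `ℚ_ℓ → ℚ_v` is onto (Mathlib `adicCompletion.padicEquiv`, uniqueness of the continuous
  `ℚ_ℓ → ℚ_v`), so Tate's theorem in the degree-one form
  `PAdicHodge.DeRhamRankOne.exists_isOpen_eq_prod_of_isDeRhamFramed` applies.
* ★ `FramedGaloisRep.exists_heckeCharacter_of_isDeRhamFramed_rat` — **every continuous character
  `ψ : Γ_ℚ → GL₁(ℚ̄_ℓ)` which is de Rham at `ℓ` for Fontaine's pinned datum comes from an algebraic Hecke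
  character of `ℚ`** (`ψ(Frob_p) = ι⁻¹(χ(ϖ_p))⁻¹` for almost all `p`): the abelian case of the Fontaine–Mazur
  conjecture over `ℚ`, with no hypothesis.

## References

* [SerreAbelianLadic1968] J.-P. Serre, *Abelian ℓ-adic representations and elliptic curves* (1968),
  Ch. III §1.1, §2.3 Thm. 2, App. A (Thm. of Tate, Cor. 2).
* [Tate1967] J. Tate, *p-divisible groups* (1967), §3.3 Thm. 2.
* [Patrikis2019] S. Patrikis, *Variations on a theorem of Tate*, Mem. AMS 1238 (2019), Prop. 2.2.1.
* [FontaineMazurGeometric1995] J.-M. Fontaine, B. Mazur, *Geometric Galois representations* (1995), §1.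
* [Conrad2011LiftingGlobal] B. Conrad, *Lifting global representations with local properties*, App. B.
-/

noncomputable section

open scoped NumberField Topology Polynomial
open NumberField IsDedekindDomain IsDedekindDomain.HeightOneSpectrum Filter Field Polynomial

namespace Literature.NumberTheory.GaloisRepresentations

/-! ### The reduction with the local input only at the completions of `K` -/

/-- **Reduction to Tate's local theorem, at the completions of `K` only.**  Let `ψ : Γ_K → GL₁(ℚ̄_ℓ)`
be continuous and suppose that at every `v ∣ ℓ` the restriction `ψ|_{Γ_{K_v}}` is locally algebraic in
the sense (hloc): on `{w ∈ I_v : Art_v(w) ∈ V_v}`, `V_v ≤ K_vˣ` open, `ψ(w) = ∏_e e(Art_v w)^{n_e}` for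
finitely many continuous `e : K_v → ℚ̄_ℓ`.  Then `ψ` comes from an algebraic Hecke character `χ` of `K`:
`ψ(Frob_v) = ι⁻¹(χ(ϖ_v))⁻¹` for almost all `v` (Serre III §2.3 Thm. 2 via the idele class character of
`ψ`, exactly as in `FramedGaloisRep.exists_heckeCharacter_of_isDeRhamFramed_of_local`).
[cite: SerreAbelianLadic1968, Ch. III §2.3 Thm. 2] [cite: Patrikis2019, Prop. 2.2.1]
[cite: Conrad2011LiftingGlobal, App. B, Def. B.1 and Prop. B.4] -/
theorem FramedGaloisRep.exists_heckeCharacter_of_local_at (K : Type) [Field K] [NumberField K]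
    (ℓ : ℕ) [Fact ℓ.Prime] (ψ : FramedGaloisRep K (PadicAlgCl ℓ) 1)
    (hlocK : ∀ (v : HeightOneSpectrum (𝓞 K)) (hv : ((ℓ : ℕ) : 𝓞 K) ∈ v.asIdeal),
      ∃ V : Subgroup (v.adicCompletion K)ˣ, IsOpen (V : Set (v.adicCompletion K)ˣ) ∧
        ∃ (s : Finset (v.adicCompletion K →+* PadicAlgCl ℓ))
          (n : (v.adicCompletion K →+* PadicAlgCl ℓ) → ℤ), (∀ e ∈ s, Continuous e) ∧
          ∀ w ∈ WeilGroup.inertia (v.adicCompletion K), canonicalArtin (v.adicCompletion K) w ∈ V →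
            (((ψ.toLocal v) (WeilGroup.toAbsGalois (v.adicCompletion K) w) : GL (Fin 1) (PadicAlgCl ℓ)) :
                Matrix (Fin 1) (Fin 1) (PadicAlgCl ℓ)) 0 0 =
              ∏ e ∈ s, e ((canonicalArtin (v.adicCompletion K) w : (v.adicCompletion K)ˣ) :
                v.adicCompletion K) ^ n e)
    (ι : PadicAlgCl ℓ ≃+* ℂ) :
    ∃ χ : HeckeCharacter K, χ.IsAlgebraic ∧
      ∀ᶠ v : HeightOneSpectrum (𝓞 K) in cofinite, χ.IsUnramifiedAt v ∧ ψ.IsUnramifiedAt v ∧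
        ψ.HasFrobCharpolyAt v (X - C (ι.symm (χ.valueAtUniformizer v)⁻¹)) := by
  classical
  -- Step 0: the open subgroups shrunk to congruence subgroups
  have hloc' : ∀ (v : HeightOneSpectrum (𝓞 K)) (hv : ((ℓ : ℕ) : 𝓞 K) ∈ v.asIdeal),
      ∃ (m : ℕ) (s : Finset (v.adicCompletion K →+* PadicAlgCl ℓ))
        (n : (v.adicCompletion K →+* PadicAlgCl ℓ) → ℤ), (∀ e ∈ s, Continuous e) ∧
        ∀ w ∈ WeilGroup.inertia (v.adicCompletion K),
          canonicalArtin (v.adicCompletion K) w ∈ HeckeCharacter.congrUnits v m →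
            (((ψ.toLocal v) (WeilGroup.toAbsGalois (v.adicCompletion K) w) : GL (Fin 1) (PadicAlgCl ℓ)) :
                Matrix (Fin 1) (Fin 1) (PadicAlgCl ℓ)) 0 0 =
              ∏ e ∈ s, e ((canonicalArtin (v.adicCompletion K) w : (v.adicCompletion K)ˣ) :
                v.adicCompletion K) ^ n e := by
    intro v hv
    obtain ⟨V, hVo, s, n, hs, hV⟩ := hlocK v hv
    obtain ⟨m, hm⟩ := HeckeCharacter.exists_congrUnits_le_of_isOpen v hVo
    exact ⟨m, s, n, hs, fun w hw hwm => hV w hw (hm hwm)⟩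
  choose m s nloc hs hloc'' using hloc'
  -- Step 1: the idele class character of `ψ`, with local–global compatibility at every place
  obtain ⟨Ψ, hK, hunr, hLG⟩ := ψ.exists_idelicCharacter_localGlobal
  -- Step 2: the places above `ℓ`, the level and the exponents
  have hfin : {v : HeightOneSpectrum (𝓞 K) | ((ℓ : ℕ) : 𝓞 K) ∈ v.asIdeal}.Finite := by
    have hI : Ideal.span {((ℓ : ℕ) : 𝓞 K)} ≠ ⊥ := by
      rw [Ne, Ideal.span_singleton_eq_bot]
      exact_mod_cast (Fact.out : ℓ.Prime).ne_zero
    refine (Ideal.finite_factors hI).subset fun v hv => ?_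
    simp only [Set.mem_setOf_eq] at hv ⊢
    exact (Ideal.dvd_span_singleton).mpr hv
  haveI : Fintype {v : HeightOneSpectrum (𝓞 K) // ((ℓ : ℕ) : 𝓞 K) ∈ v.asIdeal} :=
    Fintype.subtype hfin.toFinset fun v => by rw [Set.Finite.mem_toFinset, Set.mem_setOf_eq]
  set L : Finset (HeightOneSpectrum (𝓞 K)) := hfin.toFinset with hLdef
  have hLiff : ∀ v, v ∈ L ↔ ((ℓ : ℕ) : 𝓞 K) ∈ v.asIdeal := fun v => by
    rw [hLdef, Set.Finite.mem_toFinset, Set.mem_setOf_eq]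
  have hL : ∀ v : HeightOneSpectrum (𝓞 K), ((ℓ : ℕ) : 𝓞 K) ∈ v.asIdeal → v ∈ L := fun v hv =>
    (hLiff v).mpr hv
  -- the level `M = 1 + max_v m_v`
  set M : ℕ := (Finset.univ.sup fun vh : {v : HeightOneSpectrum (𝓞 K) // ((ℓ : ℕ) : 𝓞 K) ∈ v.asIdeal} =>
    m vh.1 vh.2) + 1 with hMdef
  have hMpos : 0 < M := Nat.succ_pos _
  have hmM : ∀ v hv, m v hv ≤ M := fun v hv =>
    (Finset.le_sup (f := fun vh : {v : HeightOneSpectrum (𝓞 K) // ((ℓ : ℕ) : 𝓞 K) ∈ v.asIdeal} =>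
      m vh.1 vh.2) (Finset.mem_univ ⟨v, hv⟩)).trans (Nat.le_succ _)
  -- the exponents, on local embeddings and on `ℓ`-adic embeddings of `K`
  set N : PadicEmbedding.PlaceEmb K ℓ → ℤ := fun p =>
    if p.2.1 ∈ s p.1.1 p.1.2 then nloc p.1.1 p.1.2 p.2.1 else 0 with hNdef
  set n : (K →+* PadicAlgCl ℓ) → ℤ := fun τ => N ((PadicEmbedding.placeEmbEquiv K ℓ).symm τ) with hndef
  -- Step 3: `Ψ` is locally algebraic at `L` with exponents `n` and level `M`
  have hLA : ∀ k : Kˣ, (∀ v ∈ L, Valued.v (algebraMap K (v.adicCompletion K) (k : K) - 1) ≤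
        WithZero.exp (-(M : ℤ))) →
      (∏ v ∈ L, ((Ψ (localUnits v (globalToLocalUnits v k)) : (PadicAlgCl ℓ)ˣ) : PadicAlgCl ℓ)) =
        ∏ τ : K →+* PadicAlgCl ℓ, τ (k : K) ^ (-(n τ)) := by
    intro k hk
    -- at one place `v ∣ ℓ`: `Ψ(⟨k⟩_v) = ψ_v(w)₀₀⁻¹ = ∏_{e ∈ s_v} e(k)^{-n_{v,e}}` for `Art w = k`
    have hplace : ∀ (v : HeightOneSpectrum (𝓞 K)) (hv : ((ℓ : ℕ) : 𝓞 K) ∈ v.asIdeal),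
        ((Ψ (localUnits v (globalToLocalUnits v k)) : (PadicAlgCl ℓ)ˣ) : PadicAlgCl ℓ) =
          ∏ e ∈ s v hv, e (algebraMap K (v.adicCompletion K) (k : K)) ^ (-(nloc v hv e)) := by
      intro v hv
      have hkv : globalToLocalUnits v k ∈ HeckeCharacter.congrUnits v (m v hv) :=
        HeckeCharacter.congrUnits_antitone v (hmM v hv)
          (HeckeCharacter.globalToLocalUnits_mem_congrUnits hMpos (hk v (hL v hv)))
      obtain ⟨w, hwI, hw⟩ := exists_inertia_canonicalArtin_eq v hkv.1
      have hart : canonicalArtin (v.adicCompletion K) w ∈ HeckeCharacter.congrUnits v (m v hv) := by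
        rw [hw]; exact hkv
      rw [← hw, coe_idelic_localUnits_canonicalArtin hLG v w, hloc'' v hv w hwI hart,
        ← Finset.prod_inv_distrib]
      refine Finset.prod_congr rfl fun e _ => ?_
      rw [zpow_neg, hw, val_globalToLocalUnits]
    calc (∏ v ∈ L, ((Ψ (localUnits v (globalToLocalUnits v k)) : (PadicAlgCl ℓ)ˣ) : PadicAlgCl ℓ))
        = ∏ vh : {v : HeightOneSpectrum (𝓞 K) // ((ℓ : ℕ) : 𝓞 K) ∈ v.asIdeal},
            ((Ψ (localUnits vh.1 (globalToLocalUnits vh.1 k)) : (PadicAlgCl ℓ)ˣ) : PadicAlgCl ℓ) :=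
          Finset.prod_subtype L hLiff _
      _ = ∏ vh : {v : HeightOneSpectrum (𝓞 K) // ((ℓ : ℕ) : 𝓞 K) ∈ v.asIdeal},
            ∏ e ∈ s vh.1 vh.2, e (algebraMap K (vh.1.adicCompletion K) (k : K)) ^ (-(nloc vh.1 vh.2 e)) :=
          Fintype.prod_congr _ _ fun vh => hplace vh.1 vh.2
      _ = ∏ vh : {v : HeightOneSpectrum (𝓞 K) // ((ℓ : ℕ) : 𝓞 K) ∈ v.asIdeal},
            ∏ eh : {e : vh.1.adicCompletion K →+* PadicAlgCl ℓ // Continuous e},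
              eh.1 (algebraMap K (vh.1.adicCompletion K) (k : K)) ^
                (-(if eh.1 ∈ s vh.1 vh.2 then nloc vh.1 vh.2 eh.1 else 0)) :=
          Fintype.prod_congr _ _ fun vh => prod_zpow_neg_eq_prod_subtype (s vh.1 vh.2) (hs vh.1 vh.2)
            (nloc vh.1 vh.2) (fun e => if e ∈ s vh.1 vh.2 then nloc vh.1 vh.2 e else 0)
            (fun e he => if_pos he) (fun e _ he => if_neg he) _
      _ = ∏ p : PadicEmbedding.PlaceEmb K ℓ,
            p.2.1 (algebraMap K (p.1.1.adicCompletion K) (k : K)) ^ (-(N p)) :=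
          (PadicEmbedding.prod_placeEmb_eq_prod_prod fun p : PadicEmbedding.PlaceEmb K ℓ =>
            p.2.1 (algebraMap K (p.1.1.adicCompletion K) (k : K)) ^ (-(N p))).symm
      _ = ∏ τ : K →+* PadicAlgCl ℓ, τ (k : K) ^ (-(n τ)) := by
          refine Fintype.prod_equiv (PadicEmbedding.placeEmbEquiv K ℓ) _ _ fun p => ?_
          show _ = _ ^ (-(N ((PadicEmbedding.placeEmbEquiv K ℓ).symm (PadicEmbedding.placeEmbEquiv K ℓ p))))
          rw [Equiv.symm_apply_apply]
          rfl
  -- Step 4: the Hecke avatar (Serre III §2.3 Thm. 2)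
  have hΨ : ∀ᶠ v : HeightOneSpectrum (𝓞 K) in cofinite, ψ.IsUnramifiedAt v ∧
      (∀ u : (v.adicCompletionIntegers K)ˣ,
          Ψ (localUnits v (Units.map ((v.adicCompletionIntegers K).subtype : _ →* _) u)) = 1) ∧
      ∀ ϖ : (v.adicCompletion K)ˣ, Valued.v (ϖ : v.adicCompletion K) = WithZero.exp (-1 : ℤ) →
        ψ.HasFrobCharpolyAt v (X - C ((Ψ (localUnits v ϖ) : (PadicAlgCl ℓ)ˣ) : PadicAlgCl ℓ)) :=
    ψ.eventually_isUnramifiedAt_of_rank_one.mono fun v hv => ⟨hv, (hunr v hv).1, (hunr v hv).2⟩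
  exact exists_heckeCharacter_of_isLocAlgAt ψ Ψ hK hΨ L hL n M hLA ι

/-! ### The local input at the completions of `ℚ` -/

/-- **Tate's theorem at `ℚ_v`, `v ∣ ℓ`.**  `ℚ_v` is an `ℓ`-adic field with `e = f = 1` (`𝒪_v ≅ ℤ_ℓ`)
onto which `ℚ_ℓ` maps, so every character `ρ : Γ_{ℚ_v} → GL₁(ℚ̄_ℓ)` de Rham for Fontaine's pinned datum is
locally algebraic: `ρ(w) = e(Art w)^m` on `{w ∈ I : Art w ∈ V}` for an open `V ≤ ℚ_vˣ` and the continuous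
embedding `e : ℚ_v ≅ ℚ_ℓ ⊂ ℚ̄_ℓ` (`PAdicHodge.DeRhamRankOne.exists_isOpen_eq_prod_of_isDeRhamFramed`).
[cite: SerreAbelianLadic1968, Ch. III, App. A, Cor. 2] [cite: Tate1967, §3.3 Thm. 2] -/
theorem exists_isOpen_eq_prod_of_isDeRhamFramed_rat (ℓ : ℕ) [Fact ℓ.Prime]
    (v : HeightOneSpectrum (𝓞 ℚ)) (hv : ((ℓ : ℕ) : 𝓞 ℚ) ∈ v.asIdeal)
    (ρ : FramedRep (absoluteGaloisGroup (v.adicCompletion ℚ)) (PadicAlgCl ℓ) 1)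
    (hρ : (PAdicHodge.fontainePstAdicCompletion v ℓ hv).IsDeRhamFramed ρ) :
    ∃ V : Subgroup (v.adicCompletion ℚ)ˣ, IsOpen (V : Set (v.adicCompletion ℚ)ˣ) ∧
      ∃ (s : Finset (v.adicCompletion ℚ →+* PadicAlgCl ℓ))
        (n : (v.adicCompletion ℚ →+* PadicAlgCl ℓ) → ℤ), (∀ e ∈ s, Continuous e) ∧
        ∀ w ∈ WeilGroup.inertia (v.adicCompletion ℚ), canonicalArtin (v.adicCompletion ℚ) w ∈ V →
          ((ρ (WeilGroup.toAbsGalois (v.adicCompletion ℚ) w) : GL (Fin 1) (PadicAlgCl ℓ)) :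
              Matrix (Fin 1) (Fin 1) (PadicAlgCl ℓ)) 0 0 =
            ∏ e ∈ s, e ((canonicalArtin (v.adicCompletion ℚ) w : (v.adicCompletion ℚ)ˣ) :
              v.adicCompletion ℚ) ^ n e := by
  classical
  -- `v` is the place of the prime `ℓ`
  obtain rfl : ((Rat.HeightOneSpectrum.primesEquiv v : Nat.Primes) : ℕ) = ℓ :=
    LocalField.primesEquiv_eq_of_natCast_mem ℓ v hv
  -- Mathlib's continuous `ℚ_v ≃ ℚ_ℓ`, as a ring isomorphism (before any `ℚ`-algebra diamond arises)
  let eQ : v.adicCompletion ℚ ≃+* ℚ_[(Rat.HeightOneSpectrum.primesEquiv v : Nat.Primes)] :=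
    (Rat.HeightOneSpectrum.adicCompletion.padicEquiv v :
      v.adicCompletion ℚ ≃+* ℚ_[(Rat.HeightOneSpectrum.primesEquiv v : Nat.Primes)])
  have heQc : Continuous eQ := (Rat.HeightOneSpectrum.adicCompletion.padicEquiv v).continuous
  have heQsc : Continuous eQ.symm := (Rat.HeightOneSpectrum.adicCompletion.padicEquiv v).symm.continuous
  let eZ : v.adicCompletionIntegers ℚ ≃+* ℤ_[(Rat.HeightOneSpectrum.primesEquiv v : Nat.Primes)] :=
    (Rat.HeightOneSpectrum.adicCompletionIntegers.padicIntEquiv v :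
      v.adicCompletionIntegers ℚ ≃+* ℤ_[(Rat.HeightOneSpectrum.primesEquiv v : Nat.Primes)])
  haveI := LocalField.charZero_adicCompletion v
  have hF := LocalField.valuation_adicCompletion_natCast_lt_one v
    ((Rat.HeightOneSpectrum.primesEquiv v : Nat.Primes) : ℕ) hv
  have hρ' : (Literature.NumberTheory.PAdicHodge.fontainePst (v.adicCompletion ℚ)
      ((Rat.HeightOneSpectrum.primesEquiv v : Nat.Primes) : ℕ) hF).IsDeRhamFramed ρ := hρ
  -- `𝒪_v ≅ ℤ_ℓ`: `e = f = 1`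
  have hπ := Literature.NumberTheory.NumberFields.isUniformizer_natCast_adicCompletion_of_padicIntEquiv v eZ
  have hq := Literature.NumberTheory.NumberFields.residueFieldCard_adicCompletion_of_padicIntEquiv v eZ
  -- `ℚ_ℓ → ℚ_v` is onto: it is the inverse of the continuous `ℚ_v ≃ ℚ_ℓ`
  have hsymm : eQ.symm.toRingHom = LocalField.padicRingHom (v.adicCompletion ℚ)
        ((Rat.HeightOneSpectrum.primesEquiv v : Nat.Primes) : ℕ) hF :=
    LocalField.eq_padicRingHom_of_continuous (v.adicCompletion ℚ) _ hF _ heQsc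
  have hdeg : Function.Surjective (LocalField.padicRingHom (v.adicCompletion ℚ)
      ((Rat.HeightOneSpectrum.primesEquiv v : Nat.Primes) : ℕ) hF) := by
    rw [← hsymm]
    intro y
    exact ⟨eQ y, eQ.symm_apply_apply y⟩
  -- the continuous embedding `ℚ_v ≅ ℚ_ℓ ⊂ ℚ̄_ℓ`
  let e : v.adicCompletion ℚ →+* PadicAlgCl ((Rat.HeightOneSpectrum.primesEquiv v : Nat.Primes) : ℕ) :=
    (algebraMap ℚ_[(Rat.HeightOneSpectrum.primesEquiv v : Nat.Primes)]
      (PadicAlgCl ((Rat.HeightOneSpectrum.primesEquiv v : Nat.Primes) : ℕ))).comp eQ.toRingHom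
  have he : Continuous e :=
    (continuous_algebraMap ℚ_[(Rat.HeightOneSpectrum.primesEquiv v : Nat.Primes)]
      (PadicAlgCl ((Rat.HeightOneSpectrum.primesEquiv v : Nat.Primes) : ℕ))).comp heQc
  exact Literature.NumberTheory.PAdicHodge.DeRhamRankOne.exists_isOpen_eq_prod_of_isDeRhamFramed
    hF hπ hq hdeg e he ρ hρ'

/-! ### The abelian Fontaine–Mazur theorem over `ℚ` -/

/-- ★ **A de Rham `ℓ`-adic character of `Γ_ℚ` comes from an algebraic Hecke character** — the
`K = ℚ` instance of the named fact `FramedGaloisRep.exists_heckeCharacter_of_isDeRhamFramed`, proved: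
every continuous `ψ : Γ_ℚ → GL₁(ℚ̄_ℓ)` which is de Rham at `ℓ` for Fontaine's pinned datum satisfies
`ψ(Frob_p) = ι⁻¹(χ(ϖ_p))⁻¹` for almost all `p`, for an algebraic Hecke character `χ` of `ℚ`.
[cite: SerreAbelianLadic1968, Ch. III §2.3 Thm. 2 and App. A Cor. 2] [cite: Patrikis2019, Prop. 2.2.1]
[cite: FontaineMazurGeometric1995, §1] -/
theorem FramedGaloisRep.exists_heckeCharacter_of_isDeRhamFramed_rat (ℓ : ℕ) [Fact ℓ.Prime]
    (ψ : FramedGaloisRep ℚ (PadicAlgCl ℓ) 1)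
    (hdR : ∀ (v : HeightOneSpectrum (𝓞 ℚ)) (hv : ((ℓ : ℕ) : 𝓞 ℚ) ∈ v.asIdeal),
      (PAdicHodge.fontainePstAdicCompletion v ℓ hv).IsDeRhamFramed (ψ.toLocal v))
    (ι : PadicAlgCl ℓ ≃+* ℂ) :
    ∃ χ : HeckeCharacter ℚ, χ.IsAlgebraic ∧
      ∀ᶠ v : HeightOneSpectrum (𝓞 ℚ) in cofinite, χ.IsUnramifiedAt v ∧ ψ.IsUnramifiedAt v ∧
        ψ.HasFrobCharpolyAt v (X - C (ι.symm (χ.valueAtUniformizer v)⁻¹)) :=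
  FramedGaloisRep.exists_heckeCharacter_of_local_at ℚ ℓ ψ
    (fun v hv => exists_isOpen_eq_prod_of_isDeRhamFramed_rat ℓ v hv (ψ.toLocal v) (hdR v hv)) ι

end Literature.NumberTheory.GaloisRepresentations

end
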